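import Mathlib
import Summits.Ventures.PercRepro2.TypedCountInduction

/-!
# Joins of configurations, sums over sub-cubes, and Harris on a sub-cube
(blind cell PercRepro2, night-3 g26, 2026-08-29; `proofs/NIGHT3-CERT.md` §35.6)

Bookkeeping for the pendant-block reduction of `TypedCountPendant.lean`:

* `join ω₁ ω₂`, `mask S ω` — the join of two configurations and the restriction to an edge set;
  a configuration supported on `S₁ ∪ S₂` (disjoint) is the join of its restrictions
  (`join_mask`, `mask_join_left`, `mask_join_right`), and the complement within `S₁ ∪ S₂` of a join
  is the join of the complements (`flipOn_union_join`);
* `sum_onS_union` — a sum over the configurations supported on `S₁ ∪ S₂` is a double sum over the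
  two sub-cubes; `sum_onS_flip` — the complement is a bijection of the sub-cube of `S`;
* `pOn S` — the weights `1/2` on `S` and `0` off `S` (the uniform law on the sub-cube of `S`),
  `weight_pOn`, `expect_pOn`, and **`harris_onS`** — Harris' inequality on that sub-cube in the
  integer-count form `2^{-|S|} (Σ_{ω ≤ 1_S} φ)(Σ_{ω ≤ 1_S} ψ) ≤ Σ_{ω ≤ 1_S} φ ψ` for monotone `φ, ψ`.

Own work; standard axioms.
-/

namespace Summit.Ventures.PercRepro2

namespace TypedDeletion

variable {V : Type*} {E : Type*}

/-! ## Joining and restricting configurations -/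

section Join

variable [DecidableEq E]

/-- The join `ω₁ ⊔ ω₂` of two configurations. -/
def join (ω₁ ω₂ : Config E) : Config E := fun e => ω₁ e || ω₂ e

/-- The restriction of `ω` to the edges of `S`. -/
def mask (S : Finset E) (ω : Config E) : Config E := fun e => ω e && decide (e ∈ S)

omit [DecidableEq E] in
/-- Evaluation of `join`. -/
lemma join_apply (ω₁ ω₂ : Config E) (e : E) : join ω₁ ω₂ e = (ω₁ e || ω₂ e) := rfl

/-- Evaluation of `mask`. -/
lemma mask_apply (S : Finset E) (ω : Config E) (e : E) : mask S ω e = (ω e && decide (e ∈ S)) := rfl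

omit [DecidableEq E] in
/-- `ω₁ ≤ ω₁ ⊔ ω₂`. -/
lemma le_join_left (ω₁ ω₂ : Config E) : ω₁ ≤ join ω₁ ω₂ := by
  intro e
  simp only [join_apply]
  cases ω₁ e <;> simp

omit [DecidableEq E] in
/-- `ω₂ ≤ ω₁ ⊔ ω₂`. -/
lemma le_join_right (ω₁ ω₂ : Config E) : ω₂ ≤ join ω₁ ω₂ := by
  intro e
  simp only [join_apply]
  cases ω₂ e <;> simp

/-- The restriction to `S` is supported on `S`. -/
lemma onS_mask (S : Finset E) (ω : Config E) : OnS S (mask S ω) := by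
  intro e he
  simp only [mask_apply, Bool.and_eq_true, decide_eq_true_eq] at he
  exact he.2

/-- The join of configurations supported on `S₁`, `S₂` is supported on `S₁ ∪ S₂`. -/
lemma onS_join {S₁ S₂ : Finset E} {ω₁ ω₂ : Config E} (h₁ : OnS S₁ ω₁) (h₂ : OnS S₂ ω₂) :
    OnS (S₁ ∪ S₂) (join ω₁ ω₂) := by
  intro e he
  simp only [join_apply, Bool.or_eq_true] at he
  rcases he with he | he
  · exact Finset.mem_union_left _ (h₁ e he)
  · exact Finset.mem_union_right _ (h₂ e he)

/-- A configuration supported on `S` is unchanged by restriction to `S`. -/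
lemma mask_of_onS {S : Finset E} {ω : Config E} (h : OnS S ω) : mask S ω = ω := by
  funext e
  simp only [mask_apply]
  by_cases he : ω e = true
  · simp [he, h e he]
  · simp at he
    simp [he]

/-- A configuration supported on `S` vanishes on a set disjoint from `S`. -/
lemma mask_eq_zero_of_onS_disjoint {S₁ S₂ : Finset E} (hd : Disjoint S₁ S₂) {ω : Config E}
    (h : OnS S₂ ω) : mask S₁ ω = fun _ => false := by
  funext e
  simp only [mask_apply]
  by_cases he : ω e = true
  · have h2 := h e he
    have h1 : e ∉ S₁ := fun h1 => Finset.disjoint_left.1 hd h1 h2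
    simp [h1]
  · simp at he
    simp [he]

/-- Restricting the join to `S₁` recovers the first factor (disjoint supports). -/
lemma mask_join_left {S₁ S₂ : Finset E} (hd : Disjoint S₁ S₂) {ω₁ ω₂ : Config E}
    (h₁ : OnS S₁ ω₁) (h₂ : OnS S₂ ω₂) : mask S₁ (join ω₁ ω₂) = ω₁ := by
  funext e
  simp only [mask_apply, join_apply]
  by_cases he1 : ω₁ e = true
  · have hS : e ∈ S₁ := h₁ e he1
    simp [he1, hS]
  · simp only [Bool.not_eq_true] at he1
    by_cases he2 : ω₂ e = true
    · have hS : e ∉ S₁ := fun h => Finset.disjoint_left.1 hd h (h₂ e he2)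
      simp [he1, he2, hS]
    · simp only [Bool.not_eq_true] at he2
      simp [he1, he2]

/-- Restricting the join to `S₂` recovers the second factor (disjoint supports). -/
lemma mask_join_right {S₁ S₂ : Finset E} (hd : Disjoint S₁ S₂) {ω₁ ω₂ : Config E}
    (h₁ : OnS S₁ ω₁) (h₂ : OnS S₂ ω₂) : mask S₂ (join ω₁ ω₂) = ω₂ := by
  funext e
  simp only [mask_apply, join_apply]
  by_cases he2 : ω₂ e = true
  · have hS : e ∈ S₂ := h₂ e he2
    simp [he2, hS]
  · simp only [Bool.not_eq_true] at he2
    by_cases he1 : ω₁ e = true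
    · have hS : e ∉ S₂ := fun h => Finset.disjoint_left.1 hd (h₁ e he1) h
      simp [he1, he2, hS]
    · simp only [Bool.not_eq_true] at he1
      simp [he1, he2]

/-- A configuration supported on `S₁ ∪ S₂` is the join of its two restrictions. -/
lemma join_mask {S₁ S₂ : Finset E} {ω : Config E} (h : OnS (S₁ ∪ S₂) ω) :
    join (mask S₁ ω) (mask S₂ ω) = ω := by
  funext e
  simp only [join_apply, mask_apply]
  by_cases he : ω e = true
  · have := h e he
    rw [Finset.mem_union] at this
    rcases this with h1 | h1 <;> simp [he, h1]
  · simp at he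
    simp [he]

/-- The complement within `S₁ ∪ S₂` of a join is the join of the complements. -/
lemma flipOn_union_join {S₁ S₂ : Finset E} (hd : Disjoint S₁ S₂) {ω₁ ω₂ : Config E}
    (h₁ : OnS S₁ ω₁) (h₂ : OnS S₂ ω₂) :
    flipOn (S₁ ∪ S₂) (join ω₁ ω₂) = join (flipOn S₁ ω₁) (flipOn S₂ ω₂) := by
  funext e
  simp only [flipOn_apply, join_apply, Finset.mem_union]
  by_cases he1 : e ∈ S₁
  · have he2 : e ∉ S₂ := fun h => Finset.disjoint_left.1 hd he1 h
    have : ω₂ e = false := by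
      by_contra hc
      exact he2 (h₂ e (by simpa using hc))
    simp [he1, he2, this]
  · by_cases he2 : e ∈ S₂
    · have : ω₁ e = false := by
        by_contra hc
        exact he1 (h₁ e (by simpa using hc))
      simp [he1, he2, this]
    · simp [he1, he2]

/-- The complement within `S` is an involution on the configurations supported on `S`. -/
lemma flipOn_flipOn {S : Finset E} {ω : Config E} (h : OnS S ω) : flipOn S (flipOn S ω) = ω := by
  funext e
  simp only [flipOn_apply]
  by_cases he : ω e = true
  · simp [he, h e he]
  · simp at he
    by_cases hS : e ∈ S <;> simp [he, hS]

/-- The complement within `S` is antitone. -/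
lemma flipOn_antitone (S : Finset E) : Antitone (flipOn S : Config E → Config E) := by
  intro ω ω' h e
  have := h e
  simp only [flipOn_apply]
  cases hω : ω e <;> cases hω' : ω' e
  · exact le_rfl
  · simp
  · rw [hω, hω'] at this
    exact absurd (Bool.le_iff_imp.1 this rfl) Bool.false_ne_true
  · exact le_rfl

end Join

/-! ## Sums over configurations supported on a union -/

section Sums

open Classical

variable [Fintype E] [DecidableEq E] {R : Type*} [CommRing R]

/-- A sum over the configurations supported on `S₁ ∪ S₂` (disjoint) is a double sum over the
configurations supported on `S₁` and on `S₂`. -/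
lemma sum_onS_union {S₁ S₂ : Finset E} (hd : Disjoint S₁ S₂) (h : Config E → R) :
    ∑ ω : Config E, (if OnS (S₁ ∪ S₂) ω then h ω else 0) =
      ∑ ω₁ : Config E, (if OnS S₁ ω₁ then
        ∑ ω₂ : Config E, (if OnS S₂ ω₂ then h (join ω₁ ω₂) else 0) else 0) := by
  classical
  have step1 : ∀ ω₁ : Config E, (if OnS S₁ ω₁ then
      ∑ ω₂ : Config E, (if OnS S₂ ω₂ then h (join ω₁ ω₂) else 0) else 0) =
      ∑ ω₂ : Config E, (if OnS S₁ ω₁ ∧ OnS S₂ ω₂ then h (join ω₁ ω₂) else 0) := by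
    intro ω₁
    by_cases h1 : OnS S₁ ω₁
    · simp [h1]
    · simp [h1]
  simp_rw [step1]
  rw [← Fintype.sum_prod_type']
  rw [← Finset.sum_filter, ← Finset.sum_filter]
  refine Finset.sum_nbij' (fun ω => (mask S₁ ω, mask S₂ ω)) (fun p => join p.1 p.2) ?_ ?_ ?_ ?_ ?_
  · intro ω hω
    simp only [Finset.mem_filter, Finset.mem_univ, true_and] at hω ⊢
    exact ⟨onS_mask _ _, onS_mask _ _⟩
  · intro p hp
    simp only [Finset.mem_filter, Finset.mem_univ, true_and] at hp ⊢
    exact onS_join hp.1 hp.2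
  · intro ω hω
    simp only [Finset.mem_filter, Finset.mem_univ, true_and] at hω
    exact join_mask hω
  · intro p hp
    simp only [Finset.mem_filter, Finset.mem_univ, true_and] at hp
    simp only [mask_join_left hd hp.1 hp.2, mask_join_right hd hp.1 hp.2]
  · intro ω hω
    simp only [Finset.mem_filter, Finset.mem_univ, true_and] at hω
    simp only [join_mask hω]

/-- The sum over the configurations supported on `S` is invariant under the complement. -/
lemma sum_onS_flip (S : Finset E) (h : Config E → R) :
    ∑ ω : Config E, (if OnS S ω then h (flipOn S ω) else 0) =
      ∑ ω : Config E, (if OnS S ω then h ω else 0) := by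
  classical
  rw [← Finset.sum_filter, ← Finset.sum_filter]
  refine Finset.sum_nbij' (flipOn S) (flipOn S) ?_ ?_ ?_ ?_ ?_
  · intro ω _
    simp only [Finset.mem_filter, Finset.mem_univ, true_and]
    exact onS_flipOn S ω
  · intro ω _
    simp only [Finset.mem_filter, Finset.mem_univ, true_and]
    exact onS_flipOn S ω
  · intro ω hω
    simp only [Finset.mem_filter, Finset.mem_univ, true_and] at hω
    exact flipOn_flipOn hω
  · intro ω hω
    simp only [Finset.mem_filter, Finset.mem_univ, true_and] at hω
    exact flipOn_flipOn hω
  · intro ω _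
    rfl

end Sums

/-! ## Harris on the uniform law of a sub-cube -/

section HarrisOn

open Classical

variable [Fintype E] [DecidableEq E] {R : Type*} [Field R] [LinearOrder R] [IsStrictOrderedRing R]

/-- The weights `1/2` on `S` and `0` off `S`: the uniform law on the configurations supported on
`S`. -/
def pOn (S : Finset E) : E → R := fun e => if e ∈ S then 1 / 2 else 0

omit [Fintype E] in
/-- `pOn S` is admissible. -/
lemma isProbVec_pOn (S : Finset E) : IsProbVec (pOn S : E → R) := by
  refine ⟨fun e => ?_, fun e => ?_⟩ <;> unfold pOn <;> split_ifs <;> norm_num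

/-- The weight of a configuration under `pOn S`. -/
lemma weight_pOn (S : Finset E) (ω : Config E) :
    weight (pOn S : E → R) ω = if OnS S ω then (1 / 2 : R) ^ S.card else 0 := by
  unfold weight
  have hfac : ∀ e, edgeFactor ((pOn S : E → R) e) (ω e) =
      (if e ∈ S then (1 / 2 : R) else 1) * (if e ∈ S then 1 else (if ω e = true then 0 else 1)) := by
    intro e
    unfold pOn
    by_cases he : e ∈ S
    · cases ω e
      · simp [he, edgeFactor]; norm_num
      · simp [he, edgeFactor]
    · cases ω e <;> simp [he, edgeFactor]
  simp_rw [hfac]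
  rw [Finset.prod_mul_distrib]
  have h1 : (∏ e, (if e ∈ S then (1 / 2 : R) else 1)) = (1 / 2 : R) ^ S.card := by
    rw [Finset.prod_ite_mem, Finset.univ_inter, Finset.prod_const]
  rw [h1]
  by_cases hS : OnS S ω
  · have h2 : (∏ e, (if e ∈ S then (1 : R) else (if ω e = true then 0 else 1))) = 1 := by
      apply Finset.prod_eq_one
      intro e _
      by_cases he : e ∈ S
      · simp [he]
      · have : ω e = false := by
          by_contra hc
          exact he (hS e (by simpa using hc))
        simp [he, this]
    rw [h2, if_pos hS, mul_one]
  · have h2 : (∏ e, (if e ∈ S then (1 : R) else (if ω e = true then 0 else 1))) = 0 := by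
      have : ∃ e, ω e = true ∧ e ∉ S := by
        by_contra hc
        exact hS fun e he => by_contra fun hn => hc ⟨e, he, hn⟩
      obtain ⟨e, he, heS⟩ := this
      exact Finset.prod_eq_zero (Finset.mem_univ e) (by simp [heS, he])
    rw [h2, if_neg hS, mul_zero]

/-- The expectation under `pOn S` is the normalised sum over the configurations supported on `S`. -/
lemma expect_pOn (S : Finset E) (f : Config E → R) :
    expect (pOn S : E → R) f = (1 / 2 : R) ^ S.card * ∑ ω : Config E, (if OnS S ω then f ω else 0) := by
  unfold expect
  rw [Finset.mul_sum]
  refine Finset.sum_congr rfl fun ω _ => ?_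
  rw [weight_pOn]
  split_ifs <;> simp

/-- **Harris on the sub-cube of `S`**: for monotone `φ, ψ`,
`2^{-|S|} (Σ_{ω ≤ 1_S} φ)(Σ_{ω ≤ 1_S} ψ) ≤ Σ_{ω ≤ 1_S} φ ψ`. -/
lemma harris_onS (S : Finset E) {φ ψ : Config E → R} (hφ : Monotone φ) (hψ : Monotone ψ) :
    (1 / 2 : R) ^ S.card * (∑ ω : Config E, (if OnS S ω then φ ω else 0)) *
        (∑ ω : Config E, (if OnS S ω then ψ ω else 0)) ≤
      ∑ ω : Config E, (if OnS S ω then φ ω * ψ ω else 0) := by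
  have key := expect_mul_expect_le_expect_mul (isProbVec_pOn S) hφ hψ
  rw [expect_pOn, expect_pOn, expect_pOn] at key
  have hc : (0 : R) < (1 / 2 : R) ^ S.card := by positivity
  have hmul : (φ * ψ) = fun ω => φ ω * ψ ω := rfl
  rw [hmul] at key
  have key' : (1 / 2 : R) ^ S.card * ((1 / 2 : R) ^ S.card *
      (∑ ω : Config E, (if OnS S ω then φ ω else 0)) *
        (∑ ω : Config E, (if OnS S ω then ψ ω else 0))) ≤
      (1 / 2 : R) ^ S.card * ∑ ω : Config E, (if OnS S ω then φ ω * ψ ω else 0) := by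
    calc _ = (1 / 2 : R) ^ S.card * (∑ ω : Config E, (if OnS S ω then φ ω else 0)) *
          ((1 / 2 : R) ^ S.card * (∑ ω : Config E, (if OnS S ω then ψ ω else 0))) := by ring
      _ ≤ _ := key
  exact le_of_mul_le_mul_left key' hc

end HarrisOn

end TypedDeletion

end Summit.Ventures.PercRepro2
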